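import Literature.Computability.AlgebraicComplexity.KronRectThirteenSixSigns
import Literature.Computability.AlgebraicComplexity.KronRectThirteenSixShared
import Literature.Computability.AlgebraicComplexity.KronRectThirteenSixAdviceB
import HarnessLib

/-!
# `k_13(6) > 0` by a memoised block-sign design certificate — part C8: entry checks, chunk 8/8 (theorem-only)

Bürgisser–Ikenmeyer 2017 §5 (Ex. 5.6, Problem 5.19) [BurgisserIkenmeyer2017] / Amanov–Yeliussizov 2022 §8
(Thm. 8.4 (ii), Cor. 8.5) [AmanovYeliussizov2022]: `k_m(δ) = g(m×δ,m×δ,m×δ) > 0` as soon as some magic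
set `T ⊆ [δ]³` with `m` cells on every axis plane has a nonzero normalised signed count of resolutions
into diagonals. The design here (78 cells, 541 diagonals) is `C_0 ⊔ C_1 ⊔ D` with
`C_r = {(x,y,z) : x + y + 2z ≡ r (mod 6)}` (two affine classes without mixed diagonals) and one more
diagonal `D`; its count is `-414`, computed in the kernel by the memoised evaluator of
`AC/KronRectDesignDAG.lean` (2274 shared states, 8 check chunks; cell `val-lit`, seat t04 g9).
Honest framing: BI 2017 §5 / AY 2022 §8 invariant-degree bookkeeping; nothing here bears on VP versus VNP.

## References
* [BurgisserIkenmeyer2017] P. Bürgisser, C. Ikenmeyer, J. Algebra 477 (2017), §5, Ex. 5.6, Problem 5.19.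
* [AmanovYeliussizov2022] A. Amanov, D. Yeliussizov, IMRN 2023 = arXiv:2202.11059, Thm. 8.4, Cor. 8.5.
-/

set_option Elab.async false
set_option maxRecDepth 200000

namespace Literature.Computability.AlgebraicComplexity

namespace KronRectThirteenSix

open DesignDAG
set_option maxHeartbeats 100000000 in
/-- Entry chunk 8/8 checks (kernel computation). [cite: AmanovYeliussizov2022, Thm. 8.4 (ii)] -/
theorem hC8 : checkEntries 78 rows dg tab E8 = true := by
  decide +kernel

end KronRectThirteenSix

end Literature.Computability.AlgebraicComplexity
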